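import Mathlib
import HarnessLib
import Summits.Ventures.LatticeQCDFlow.Scoring.IMHAcceptanceRecordJumpBurnIn

/-!
# The IMH acceptance record XI: the rate `1 − ā` is attained — top and bottom states,
# and the sector mis-weighting model solved exactly

HONEST FRAMING: exact (Metropolis-corrected) sampling algorithms for lattice gauge theory; figures
of merit are autocorrelation/cost numbers at stated couplings and volumes; no continuum-physics
claim.  This file is value-free (no number of ours appears) and nothing in it is cited as a fact.

NEW WORK (tree-internal).  VII (`IMHAcceptanceRecordJumpKernel`) minorised the jump kernel
`J̃ = imhJump q w` (law of the next ACCEPTED proposal of the flow-MCMC / independence chain, weight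
`w = dπ/dq > 0`) by its invariant tilt `π̃ = imhTilt q w π` with the MEAN ACCEPTANCE `ā = ∫ α dπ`
as constant, and X (`IMHAcceptanceRecordJumpBurnIn`) deduced `|J̃ᵗ(x, S) − π̃(S)| ≤ (1 − ā)ᵗ` for
every start.  X's NOT-CLAIMED list named the optimality of the rate `1 − ā`; it is settled here.
* TOP AND BOTTOM STATES (§1; `w` measurable, `w > 0`, `w · q = π` a probability law).  Where the
  weight is maximal, `α(x⁺) = 1 / w(x⁺)` and `J̃(x⁺, ·) = π` EXACTLY (`imhJump_of_top`: one
  acceptance from a modal state regenerates the target — rejection sampling in kernel form); where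
  it is minimal, `α(x₋) = 1` and `J̃(x₋, ·) = q` (`imhJump_of_bot`).  Hence VII's constant is
  OPTIMAL: if the weight attains its maximum and is minimal on a set of positive model mass, the
  single pair (modal state, minimal set) forces every `c` with `c · π̃ ≤ J̃(x, ·)` to satisfy
  `c ≤ ā` (`le_lintegral_imhAcceptMass_of_minorisation`, `…_of_forall_minorisation`).
* THE SECTOR MIS-WEIGHTING MODEL (§2).  `H` a measurable set on which the weight is maximal and off
  which it is minimal (`w` two-valued: the model `q` is the target conditioned correctly inside each
  "sector" `H`, `Hᶜ` but mis-weights the sectors, `H` being the under-weighted one).  Everything is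
  explicit: `J̃ = π` on `H`, `= q` off `H`; `ā = π(Hᶜ) + q(H)`, i.e. `1 − ā = π(H) − q(H)` = THE
  SECTOR DEFICIT (`one_sub_toReal_lintegral_imhAcceptMass_sector`); the accepted stream's
  equilibrium occupation is `π̃(H) = q(H) / ā`; and for EVERY start `x`, EVERY `t`, EVERY
  measurable `B`:  `J̃ᵗ(x, H) − π̃(H) = (1_H(x) − π̃(H)) · (1 − ā)ᵗ` and
  `J̃ᵗ⁺¹(x, B) − π̃(B) = (π(B) − q(B)) · (1_H(x) − π̃(H)) · (1 − ā)ᵗ`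
  (`real_nHit_imhJump_sector_sub_eq`, `real_nHit_succ_imhJump_sector_sub_eq`): EQUALITY — every
  set occupation of the accepted stream relaxes as an exact geometric sequence of ratio `1 − ā`,
  monotonically and without overshoot.
* SHARPNESS OF X AND VII (§3).  With both sectors non-empty, `sup_x |J̃ᵗ(x, H) − π̃(H)| ≥ ½(1 − ā)ᵗ`
  at EVERY `t` (`exists_half_pow_le_abs_nHit_imhJump_sub`): X's envelope is attained up to the
  factor `2` uniformly in `t`, so neither the base `1 − ā` of X's bound nor the constant `ā` of
  VII's minorisation (`le_lintegral_imhAcceptMass_of_minorisation_sector`) can be improved as a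
  function of the mean acceptance alone.

PRINTED COUNTERPARTS AND TREE CONTEXT, NAMED ONLY (nothing below is imported as a fact; labels by
source, presearch of record in the seat notes).  For the BASE chain: Liu's eigen-analysis of the
Metropolised independence sampler (eigenvalues = rejection probabilities, rate `1 − 1/sup w`)
[corpus:book:liund-monte-carlo-strategies-scientific-computing p.245 Thm 13.4.1;
galaxy:panama:212996018143295], its coupling bound on general spaces [ibid. p.246], in the tree in
finite form as `IMHLiuSpectrum`, `IMHLiuSpectrumGap`, `IMHAutocorrelationEnvelope` and
`Literature…MengersenTweedie.imh_row_mode` / `imh_lawAt_single_mode` [Wang2022IMH, Remark 1;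
Liu1996IMH, Thm 2.1] — of which `imhJump_of_top` is the general-space, jump-kernel form (the
rejection-sampling identity [ibid. p.29]); the generic Doeblin envelope is sharp in `ε` alone via
the LAZY kernel (`DoeblinEnvelopeSharp`), which is not a jump kernel; the jump-chain representation
of accepted states [galaxy:pdf:-7173847574603489160 p.2, Lemma 1]; uniform ergodicity of the
accepted-state chain under a bounded weight [corpus:paper:arxiv-1910.13316 p.4 §3],
[corpus:paper:arxiv-1609.02541 p.12 §6].  The exact solution of the ACCEPTED-STATE chain of a
two-valued weight with the mean acceptance as exact ratio, and the optimality of `ā` as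
minorisation constant of `J̃` by `π̃`, are tree-internal (this file); no printed source is claimed.

NOT CLAIMED: any number of ours; that `1 − ā` is the exact rate for weights with three or more
values (there the accepted stream can relax strictly faster; only X's bound is asserted in general);
anything on the base chain's time-`t` marginal; a lattice instance (VII's lattice hypotheses export
bounds on `w`, not attainment of its supremum); a CLT for the accepted stream.
-/

noncomputable section

namespace Summit.Ventures.LatticeQCDFlow.Scoring

open MeasureTheory ProbabilityTheory Filter Finset Summit.Ventures.LatticeQCDFlow.Exactness
open scoped ENNReal Topology

variable {Ω : Type*} [MeasurableSpace Ω] {q : Measure Ω} [IsProbabilityMeasure q] {w : Ω → ℝ}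
  {π : Measure Ω}

/-! ### §0 Elementary facts -/

namespace JumpSharp

omit [IsProbabilityMeasure q] in
/-- Normalisation of the weight: `∫ w dq = π(Ω) = 1`. -/
theorem lintegral_ofReal_eq_one [IsProbabilityMeasure π]
    (hπ : (q.withDensity fun x => ENNReal.ofReal (w x)) = π) :
    ∫⁻ y, ENNReal.ofReal (w y) ∂q = 1 := by
  rw [← setLIntegral_univ, ← withDensity_apply _ MeasurableSet.univ, hπ, measure_univ]

omit [IsProbabilityMeasure q] in
/-- A set of positive model mass has positive target mass (`w > 0`). -/
theorem apply_ne_zero_of_model (hw : Measurable w) (hw0 : ∀ x, 0 < w x)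
    (hπ : (q.withDensity fun x => ENNReal.ofReal (w x)) = π) {B : Set Ω} (hqB : q B ≠ 0) :
    π B ≠ 0 := by
  rwa [← hπ, Ne, withDensity_apply_eq_zero hw.ennreal_ofReal,
    Set.eq_univ_of_forall (s := {x | ENNReal.ofReal (w x) ≠ 0})
      fun x => (ENNReal.ofReal_pos.2 (hw0 x)).ne', Set.univ_inter]

/-- The `0`-fold jump law is the point mass: `J̃⁰(x, S) = 1_S(x)`. -/
theorem real_nHit_zero (κ : Kernel Ω Ω) (x : Ω) {S : Set Ω} (hS : MeasurableSet S) :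
    (nHit κ 0 x).real S = S.indicator 1 x := by
  rw [nHit_zero, Kernel.id_apply, measureReal_def, Measure.dirac_apply' x hS]
  by_cases hx : x ∈ S <;> simp [hx]

/-- `0 ≤ 1 − ā`. -/
theorem one_sub_toReal_nonneg (π : Measure Ω) [IsProbabilityMeasure π] :
    0 ≤ 1 - (∫⁻ y, imhAcceptMass q w y ∂π).toReal := sub_nonneg.2
  ((ENNReal.toReal_mono ENNReal.one_ne_top (lintegral_imhAcceptMass_le_one π)).trans_eq
    ENNReal.toReal_one)

end JumpSharp

/-! ### §1 Top and bottom states of a general weight -/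

omit [MeasurableSpace Ω] [IsProbabilityMeasure q] in
/-- At a TOP state (`w y ≤ w x` for all `y`) the acceptance density is `w(y) / w(x)`. -/
theorem imhAcceptE_of_top (hw0 : ∀ x, 0 < w x) {x : Ω} (htop : ∀ y, w y ≤ w x) (y : Ω) :
    imhAcceptE w x y = ENNReal.ofReal ((w x)⁻¹) * ENNReal.ofReal (w y) := by
  unfold imhAcceptE imhAccept
  rw [min_eq_right ((div_le_one (hw0 x)).2 (htop y)), div_eq_inv_mul,
    ENNReal.ofReal_mul (inv_nonneg.2 (hw0 x).le)]

omit [IsProbabilityMeasure q] in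
/-- At a top state the acceptance rate is `α(x) = 1 / w(x)`. -/
theorem imhAcceptMass_of_top (hw : Measurable w) (hw0 : ∀ x, 0 < w x) [IsProbabilityMeasure π]
    (hπ : (q.withDensity fun x => ENNReal.ofReal (w x)) = π) {x : Ω} (htop : ∀ y, w y ≤ w x) :
    imhAcceptMass q w x = ENNReal.ofReal ((w x)⁻¹) := by
  unfold imhAcceptMass
  simp_rw [imhAcceptE_of_top hw0 htop, lintegral_const_mul _ hw.ennreal_ofReal,
    JumpSharp.lintegral_ofReal_eq_one hπ, mul_one]

/-- **ONE ACCEPTANCE FROM A MODAL STATE REGENERATES THE TARGET**: at a top state,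
`J̃(x, ·) = π` exactly. -/
theorem imhJump_of_top (hw : Measurable w) (hw0 : ∀ x, 0 < w x) [IsProbabilityMeasure π]
    (hπ : (q.withDensity fun x => ENNReal.ofReal (w x)) = π) {x : Ω} (htop : ∀ y, w y ≤ w x) :
    imhJump q w x = π := by
  have hc0 : ENNReal.ofReal ((w x)⁻¹) ≠ 0 := (ENNReal.ofReal_pos.2 (inv_pos.2 (hw0 x))).ne'
  ext B hB
  rw [imhJump_apply' hw x B, imhAcceptMass_of_top hw hw0 hπ htop]
  simp_rw [imhAcceptE_of_top hw0 htop]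
  rw [lintegral_const_mul _ hw.ennreal_ofReal, ← mul_assoc,
    ENNReal.inv_mul_cancel hc0 ENNReal.ofReal_ne_top, one_mul, ← withDensity_apply _ hB, hπ]

omit [MeasurableSpace Ω] [IsProbabilityMeasure q] in
/-- At a BOTTOM state (`w x ≤ w y` for all `y`) every proposal is accepted: `a(x, y) = 1`. -/
theorem imhAcceptE_of_bot (hw0 : ∀ x, 0 < w x) {x : Ω} (hbot : ∀ y, w x ≤ w y) (y : Ω) :
    imhAcceptE w x y = 1 := by
  unfold imhAcceptE imhAccept
  rw [min_eq_left ((one_le_div (hw0 x)).2 (hbot y)), ENNReal.ofReal_one]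

/-- At a bottom state the acceptance rate is `α(x) = 1`. -/
theorem imhAcceptMass_of_bot (hw0 : ∀ x, 0 < w x) {x : Ω} (hbot : ∀ y, w x ≤ w y) :
    imhAcceptMass q w x = 1 := by
  unfold imhAcceptMass
  simp_rw [imhAcceptE_of_bot hw0 hbot, lintegral_const, measure_univ, mul_one]

/-- **From a bottom state the next accepted state is a fresh model draw**: `J̃(x, ·) = q`. -/
theorem imhJump_of_bot (hw : Measurable w) (hw0 : ∀ x, 0 < w x) {x : Ω}
    (hbot : ∀ y, w x ≤ w y) : imhJump q w x = q := by
  ext B hB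
  rw [imhJump_apply' hw x B, imhAcceptMass_of_bot hw0 hbot, inv_one, one_mul]
  simp_rw [imhAcceptE_of_bot hw0 hbot, setLIntegral_one]

/-- The tilt of a set of bottom states: `π̃(B₀) = ā⁻¹ · π(B₀)` (`α = 1` on `B₀`). -/
theorem imhTilt_apply_of_bot (hw0 : ∀ x, 0 < w x) {B₀ : Set Ω} (hB₀ : MeasurableSet B₀)
    (hbot : ∀ y ∈ B₀, ∀ z, w y ≤ w z) :
    imhTilt q w π B₀ = (∫⁻ y, imhAcceptMass q w y ∂π)⁻¹ * π B₀ := by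
  rw [imhTilt, Measure.smul_apply, smul_eq_mul, withDensity_apply _ hB₀,
    setLIntegral_congr_fun hB₀ (g := fun _ => 1)
      (fun y hy => imhAcceptMass_of_bot (q := q) hw0 (hbot y hy)), setLIntegral_one]

/-- **VII'S CONSTANT IS OPTIMAL.**  If the weight is maximal at `x⁺` and minimal on a set `B₀` of
positive model mass, then any `c` with `c · π̃(B₀) ≤ J̃(x⁺, B₀)` — in particular any uniform
minorisation constant of the jump chain by its invariant tilt — satisfies `c ≤ ā = ∫ α dπ`. -/
theorem le_lintegral_imhAcceptMass_of_minorisation (hw : Measurable w) (hw0 : ∀ x, 0 < w x)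
    [IsProbabilityMeasure π] (hπ : (q.withDensity fun x => ENNReal.ofReal (w x)) = π)
    {xt : Ω} (htop : ∀ y, w y ≤ w xt) {B₀ : Set Ω} (hB₀ : MeasurableSet B₀)
    (hbot : ∀ y ∈ B₀, ∀ z, w y ≤ w z) (hqB₀ : q B₀ ≠ 0) {c : ℝ≥0∞}
    (hc : c * imhTilt q w π B₀ ≤ imhJump q w xt B₀) :
    c ≤ ∫⁻ y, imhAcceptMass q w y ∂π := by
  rw [imhJump_of_top hw hw0 hπ htop, imhTilt_apply_of_bot hw0 hB₀ hbot, ← mul_assoc] at hc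
  have h1 : c * (∫⁻ y, imhAcceptMass q w y ∂π)⁻¹ ≤ 1 :=
    (ENNReal.mul_le_mul_iff_left (JumpSharp.apply_ne_zero_of_model hw hw0 hπ hqB₀)
      (measure_ne_top π B₀)).1 (hc.trans_eq (one_mul _).symm)
  rwa [ENNReal.mul_inv_le_iff (lintegral_imhAcceptMass_ne_zero hw hw0)
    (ne_top_of_le_ne_top ENNReal.one_ne_top (lintegral_imhAcceptMass_le_one π)), one_mul] at h1

/-- Uniform form: under the same attainment hypotheses, every uniform minorisation constant of
`J̃` by `π̃` is at most the mean acceptance. -/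
theorem le_lintegral_imhAcceptMass_of_forall_minorisation (hw : Measurable w) (hw0 : ∀ x, 0 < w x)
    [IsProbabilityMeasure π] (hπ : (q.withDensity fun x => ENNReal.ofReal (w x)) = π) {xt : Ω}
    (htop : ∀ y, w y ≤ w xt) {B₀ : Set Ω} (hB₀ : MeasurableSet B₀) (hbot : ∀ y ∈ B₀, ∀ z, w y ≤ w z)
    (hqB₀ : q B₀ ≠ 0) {c : ℝ≥0∞}
    (hc : ∀ x, ∀ ⦃B : Set Ω⦄, MeasurableSet B → c * imhTilt q w π B ≤ imhJump q w x B) :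
    c ≤ ∫⁻ y, imhAcceptMass q w y ∂π :=
  le_lintegral_imhAcceptMass_of_minorisation hw hw0 hπ htop hB₀ hbot hqB₀ (hc xt hB₀)

/-! ### §2 The sector mis-weighting model: exact solution of the accepted stream -/

/-- **The jump kernel of the sector model integrates explicitly**: for any law `μ` and any set
`B`, `∫ J̃(y, B) μ(dy) = π(B) μ(H) + q(B) μ(Hᶜ)` (`J̃ = π` on `H`, `= q` off `H`). -/
theorem lintegral_imhJump_sector (hw : Measurable w) (hw0 : ∀ x, 0 < w x) [IsProbabilityMeasure π]
    (hπ : (q.withDensity fun x => ENNReal.ofReal (w x)) = π) {H : Set Ω} (hH : MeasurableSet H)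
    (htop : ∀ x ∈ H, ∀ y, w y ≤ w x) (hbot : ∀ x ∉ H, ∀ y, w x ≤ w y) (μ : Measure Ω)
    (B : Set Ω) : ∫⁻ y, imhJump q w y B ∂μ = π B * μ H + q B * μ Hᶜ := by
  rw [← lintegral_add_compl _ hH,
    setLIntegral_congr_fun hH (g := fun _ => π B)
      (fun y hy => by simp only; rw [imhJump_of_top hw hw0 hπ (htop y hy)]),
    setLIntegral_congr_fun hH.compl (g := fun _ => q B)
      (fun y hy => by simp only; rw [imhJump_of_bot hw hw0 (hbot y hy)]),
    setLIntegral_const, setLIntegral_const]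

/-- One more acceptance: `J̃ᵗ⁺¹(x, B) = π(B) J̃ᵗ(x, H) + q(B) J̃ᵗ(x, Hᶜ)`. -/
theorem nHit_succ_imhJump_sector (hw : Measurable w) (hw0 : ∀ x, 0 < w x) [IsProbabilityMeasure π]
    (hπ : (q.withDensity fun x => ENNReal.ofReal (w x)) = π) {H : Set Ω} (hH : MeasurableSet H)
    (htop : ∀ x ∈ H, ∀ y, w y ≤ w x) (hbot : ∀ x ∉ H, ∀ y, w x ≤ w y) (t : ℕ) (x : Ω)
    {B : Set Ω} (hB : MeasurableSet B) :
    nHit (imhJump q w) (t + 1) x B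
      = π B * nHit (imhJump q w) t x H + q B * nHit (imhJump q w) t x Hᶜ := by
  rw [nHit_succ, Kernel.comp_apply' _ _ _ hB, lintegral_imhJump_sector hw hw0 hπ hH htop hbot _ B]

/-- The tilt solves the same one-step equation: `π̃(B) = π(B) π̃(H) + q(B) π̃(Hᶜ)`. -/
theorem imhTilt_sector (hw : Measurable w) (hw0 : ∀ x, 0 < w x) [IsProbabilityMeasure π]
    (hπ : (q.withDensity fun x => ENNReal.ofReal (w x)) = π) {H : Set Ω} (hH : MeasurableSet H)
    (htop : ∀ x ∈ H, ∀ y, w y ≤ w x) (hbot : ∀ x ∉ H, ∀ y, w x ≤ w y) {B : Set Ω}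
    (hB : MeasurableSet B) :
    imhTilt q w π B = π B * imhTilt q w π H + q B * imhTilt q w π Hᶜ := by
  conv_lhs => rw [← (imhJump_invariant hw hw0 hπ).def]
  rw [Measure.bind_apply hB (Kernel.aemeasurable _),
    lintegral_imhJump_sector hw hw0 hπ hH htop hbot _ B]

/-- **MEAN ACCEPTANCE OF THE SECTOR MODEL**: `ā = π(Hᶜ) + q(H)`. -/
theorem lintegral_imhAcceptMass_sector (hw : Measurable w) (hw0 : ∀ x, 0 < w x)
    [IsProbabilityMeasure π] (hπ : (q.withDensity fun x => ENNReal.ofReal (w x)) = π)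
    {H : Set Ω} (hH : MeasurableSet H) (htop : ∀ x ∈ H, ∀ y, w y ≤ w x)
    (hbot : ∀ x ∉ H, ∀ y, w x ≤ w y) :
    ∫⁻ y, imhAcceptMass q w y ∂π = π Hᶜ + q H := by
  rw [← lintegral_add_compl _ hH, add_comm]
  congr 1
  · rw [setLIntegral_congr_fun hH.compl (g := fun _ => 1)
      (fun y hy => imhAcceptMass_of_bot (q := q) hw0 (hbot y hy)), setLIntegral_one]
  · subst hπ
    rw [setLIntegral_withDensity_eq_setLIntegral_mul _ hw.ennreal_ofReal
      (measurable_imhAcceptMass q hw) hH, setLIntegral_congr_fun hH (g := fun _ => 1)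
      (fun y hy => ?_), setLIntegral_one]
    rw [Pi.mul_apply, imhAcceptMass_of_top hw hw0 rfl (htop y hy),
      ← ENNReal.ofReal_mul (hw0 y).le, mul_inv_cancel₀ (hw0 y).ne', ENNReal.ofReal_one]

/-- **THE DEFICIT IDENTITY**: `1 − ā = π(H) − q(H)`, the target-minus-model mass of the
under-weighted sector. -/
theorem one_sub_toReal_lintegral_imhAcceptMass_sector (hw : Measurable w) (hw0 : ∀ x, 0 < w x)
    [IsProbabilityMeasure π] (hπ : (q.withDensity fun x => ENNReal.ofReal (w x)) = π)
    {H : Set Ω} (hH : MeasurableSet H) (htop : ∀ x ∈ H, ∀ y, w y ≤ w x)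
    (hbot : ∀ x ∉ H, ∀ y, w x ≤ w y) :
    1 - (∫⁻ y, imhAcceptMass q w y ∂π).toReal = π.real H - q.real H := by
  rw [lintegral_imhAcceptMass_sector hw hw0 hπ hH htop hbot,
    ENNReal.toReal_add (measure_ne_top _ _) (measure_ne_top _ _), ← measureReal_def,
    ← measureReal_def, probReal_compl_eq_one_sub hH]
  ring

/-- Hence the model under-weights the top sector: `q(H) ≤ π(H)`. -/
theorem real_model_le_real_target_sector (hw : Measurable w) (hw0 : ∀ x, 0 < w x)
    [IsProbabilityMeasure π] (hπ : (q.withDensity fun x => ENNReal.ofReal (w x)) = π) {H : Set Ω}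
    (hH : MeasurableSet H) (htop : ∀ x ∈ H, ∀ y, w y ≤ w x) (hbot : ∀ x ∉ H, ∀ y, w x ≤ w y) :
    q.real H ≤ π.real H :=
  sub_nonneg.1 ((JumpSharp.one_sub_toReal_nonneg (q := q) (w := w) π).trans_eq
    (one_sub_toReal_lintegral_imhAcceptMass_sector hw hw0 hπ hH htop hbot))

/-- One more acceptance, real form: `J̃ᵗ⁺¹(x, B) = q(B) + (π(B) − q(B)) · J̃ᵗ(x, H)`. -/
theorem real_nHit_succ_imhJump_sector (hw : Measurable w) (hw0 : ∀ x, 0 < w x)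
    [IsProbabilityMeasure π] (hπ : (q.withDensity fun x => ENNReal.ofReal (w x)) = π)
    {H : Set Ω} (hH : MeasurableSet H) (htop : ∀ x ∈ H, ∀ y, w y ≤ w x)
    (hbot : ∀ x ∉ H, ∀ y, w x ≤ w y) (t : ℕ) (x : Ω) {B : Set Ω} (hB : MeasurableSet B) :
    (nHit (imhJump q w) (t + 1) x).real B
      = q.real B + (π.real B - q.real B) * (nHit (imhJump q w) t x).real H := by
  haveI := isMarkovKernel_imhJump (q := q) hw hw0
  haveI := isMarkovKernel_nHit (imhJump q w) t
  rw [measureReal_def, nHit_succ_imhJump_sector hw hw0 hπ hH htop hbot t x hB,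
    ENNReal.toReal_add (ENNReal.mul_ne_top (measure_ne_top _ _) (measure_ne_top _ _))
      (ENNReal.mul_ne_top (measure_ne_top _ _) (measure_ne_top _ _)),
    ENNReal.toReal_mul, ENNReal.toReal_mul, ← measureReal_def, ← measureReal_def,
    ← measureReal_def, ← measureReal_def, probReal_compl_eq_one_sub hH]
  ring

/-- The tilt, real form: `π̃(B) = q(B) + (π(B) − q(B)) · π̃(H)`. -/
theorem real_imhTilt_sector (hw : Measurable w) (hw0 : ∀ x, 0 < w x) [IsProbabilityMeasure π]
    (hπ : (q.withDensity fun x => ENNReal.ofReal (w x)) = π) {H : Set Ω} (hH : MeasurableSet H)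
    (htop : ∀ x ∈ H, ∀ y, w y ≤ w x) (hbot : ∀ x ∉ H, ∀ y, w x ≤ w y) {B : Set Ω}
    (hB : MeasurableSet B) :
    (imhTilt q w π).real B = q.real B + (π.real B - q.real B) * (imhTilt q w π).real H := by
  haveI := isProbabilityMeasure_imhTilt (q := q) (π := π) hw hw0
  rw [measureReal_def, imhTilt_sector hw hw0 hπ hH htop hbot hB,
    ENNReal.toReal_add (ENNReal.mul_ne_top (measure_ne_top _ _) (measure_ne_top _ _))
      (ENNReal.mul_ne_top (measure_ne_top _ _) (measure_ne_top _ _)),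
    ENNReal.toReal_mul, ENNReal.toReal_mul, ← measureReal_def, ← measureReal_def,
    ← measureReal_def, ← measureReal_def, probReal_compl_eq_one_sub hH]
  ring

/-- **EQUILIBRIUM SECTOR OCCUPATION OF THE ACCEPTED STREAM**: `π̃(H) = q(H) / ā`. -/
theorem real_imhTilt_sector_eq_div (hw : Measurable w) (hw0 : ∀ x, 0 < w x)
    [IsProbabilityMeasure π] (hπ : (q.withDensity fun x => ENNReal.ofReal (w x)) = π)
    {H : Set Ω} (hH : MeasurableSet H) (htop : ∀ x ∈ H, ∀ y, w y ≤ w x)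
    (hbot : ∀ x ∉ H, ∀ y, w x ≤ w y) :
    (imhTilt q w π).real H = q.real H / (∫⁻ y, imhAcceptMass q w y ∂π).toReal := by
  have hā : (∫⁻ y, imhAcceptMass q w y ∂π).toReal ≠ 0 := ENNReal.toReal_ne_zero.2
    ⟨lintegral_imhAcceptMass_ne_zero hw hw0,
      ne_top_of_le_ne_top ENNReal.one_ne_top (lintegral_imhAcceptMass_le_one π)⟩
  have hfix := real_imhTilt_sector hw hw0 hπ hH htop hbot hH
  rw [← one_sub_toReal_lintegral_imhAcceptMass_sector hw hw0 hπ hH htop hbot] at hfix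
  rw [eq_div_iff hā]; linear_combination hfix

/-- **EXACT GEOMETRIC RELAXATION OF THE SECTOR OCCUPATION** (deficit form): for every start `x`
and every `t`, `J̃ᵗ(x, H) − π̃(H) = (1_H(x) − π̃(H)) · (π(H) − q(H))ᵗ`. -/
theorem real_nHit_imhJump_sector_sub_eq_deficit (hw : Measurable w) (hw0 : ∀ x, 0 < w x)
    [IsProbabilityMeasure π] (hπ : (q.withDensity fun x => ENNReal.ofReal (w x)) = π)
    {H : Set Ω} (hH : MeasurableSet H) (htop : ∀ x ∈ H, ∀ y, w y ≤ w x)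
    (hbot : ∀ x ∉ H, ∀ y, w x ≤ w y) (t : ℕ) (x : Ω) :
    (nHit (imhJump q w) t x).real H - (imhTilt q w π).real H
      = (H.indicator 1 x - (imhTilt q w π).real H) * (π.real H - q.real H) ^ t := by
  induction t with
  | zero => rw [JumpSharp.real_nHit_zero _ x hH, pow_zero, mul_one]
  | succ t ih =>
    have hfix := real_imhTilt_sector hw hw0 hπ hH htop hbot hH
    rw [real_nHit_succ_imhJump_sector hw hw0 hπ hH htop hbot t x hH, pow_succ]
    linear_combination (π.real H - q.real H) * ih - hfix

/-- **EXACT GEOMETRIC RELAXATION AT THE RATE `1 − ā`**: for every start `x` and every `t`,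
`J̃ᵗ(x, H) − π̃(H) = (1_H(x) − π̃(H)) · (1 − ā)ᵗ` — X's rate is attained, with equality. -/
theorem real_nHit_imhJump_sector_sub_eq (hw : Measurable w) (hw0 : ∀ x, 0 < w x)
    [IsProbabilityMeasure π] (hπ : (q.withDensity fun x => ENNReal.ofReal (w x)) = π)
    {H : Set Ω} (hH : MeasurableSet H) (htop : ∀ x ∈ H, ∀ y, w y ≤ w x)
    (hbot : ∀ x ∉ H, ∀ y, w x ≤ w y) (t : ℕ) (x : Ω) :
    (nHit (imhJump q w) t x).real H - (imhTilt q w π).real H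
      = (H.indicator 1 x - (imhTilt q w π).real H)
        * (1 - (∫⁻ y, imhAcceptMass q w y ∂π).toReal) ^ t := by
  rw [one_sub_toReal_lintegral_imhAcceptMass_sector hw hw0 hπ hH htop hbot]
  exact real_nHit_imhJump_sector_sub_eq_deficit hw hw0 hπ hH htop hbot t x

/-- **EVERY SET OCCUPATION RELAXES GEOMETRICALLY AT THE RATE `1 − ā`**: for every start `x`,
every `t` and every measurable `B`,
`J̃ᵗ⁺¹(x, B) − π̃(B) = (π(B) − q(B)) · (1_H(x) − π̃(H)) · (1 − ā)ᵗ`. -/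
theorem real_nHit_succ_imhJump_sector_sub_eq (hw : Measurable w) (hw0 : ∀ x, 0 < w x)
    [IsProbabilityMeasure π] (hπ : (q.withDensity fun x => ENNReal.ofReal (w x)) = π)
    {H : Set Ω} (hH : MeasurableSet H) (htop : ∀ x ∈ H, ∀ y, w y ≤ w x)
    (hbot : ∀ x ∉ H, ∀ y, w x ≤ w y) (t : ℕ) (x : Ω) {B : Set Ω} (hB : MeasurableSet B) :
    (nHit (imhJump q w) (t + 1) x).real B - (imhTilt q w π).real B
      = (π.real B - q.real B) * (H.indicator 1 x - (imhTilt q w π).real H)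
        * (1 - (∫⁻ y, imhAcceptMass q w y ∂π).toReal) ^ t := by
  rw [real_nHit_succ_imhJump_sector hw hw0 hπ hH htop hbot t x hB,
    real_imhTilt_sector hw hw0 hπ hH htop hbot hB, mul_assoc,
    ← real_nHit_imhJump_sector_sub_eq hw hw0 hπ hH htop hbot t x]
  ring

/-! ### §3 Sharpness of X's envelope and of VII's constant -/

/-- Absolute form: `|J̃ᵗ(x, H) − π̃(H)| = |1_H(x) − π̃(H)| · (1 − ā)ᵗ`. -/
theorem abs_real_nHit_imhJump_sector_sub_eq (hw : Measurable w) (hw0 : ∀ x, 0 < w x)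
    [IsProbabilityMeasure π] (hπ : (q.withDensity fun x => ENNReal.ofReal (w x)) = π)
    {H : Set Ω} (hH : MeasurableSet H) (htop : ∀ x ∈ H, ∀ y, w y ≤ w x)
    (hbot : ∀ x ∉ H, ∀ y, w x ≤ w y) (t : ℕ) (x : Ω) :
    |(nHit (imhJump q w) t x).real H - (imhTilt q w π).real H|
      = |H.indicator 1 x - (imhTilt q w π).real H|
        * (1 - (∫⁻ y, imhAcceptMass q w y ∂π).toReal) ^ t := by
  rw [real_nHit_imhJump_sector_sub_eq hw hw0 hπ hH htop hbot t x, abs_mul, abs_pow,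
    abs_of_nonneg (JumpSharp.one_sub_toReal_nonneg π)]

/-- **X'S ENVELOPE IS ATTAINED UP TO THE FACTOR 2, AT EVERY `t`**: if both sectors are non-empty,
some start `x` has `½ (1 − ā)ᵗ ≤ |J̃ᵗ(x, H) − π̃(H)|` (X: `≤ (1 − ā)ᵗ` for every `x`). -/
theorem exists_half_pow_le_abs_nHit_imhJump_sub (hw : Measurable w) (hw0 : ∀ x, 0 < w x)
    [IsProbabilityMeasure π] (hπ : (q.withDensity fun x => ENNReal.ofReal (w x)) = π)
    {H : Set Ω} (hH : MeasurableSet H) (htop : ∀ x ∈ H, ∀ y, w y ≤ w x)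
    (hbot : ∀ x ∉ H, ∀ y, w x ≤ w y) (hne : H.Nonempty) (hne' : Hᶜ.Nonempty) (t : ℕ) :
    ∃ x, (1 / 2) * (1 - (∫⁻ y, imhAcceptMass q w y ∂π).toReal) ^ t
      ≤ |(nHit (imhJump q w) t x).real H - (imhTilt q w π).real H| := by
  haveI := isProbabilityMeasure_imhTilt (q := q) (π := π) hw hw0
  have hr := JumpSharp.one_sub_toReal_nonneg (q := q) (w := w) π
  obtain ⟨⟨x₁, hx₁⟩, ⟨x₀, hx₀⟩⟩ := And.intro hne hne'
  by_cases h : (1 / 2 : ℝ) ≤ (imhTilt q w π).real H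
  · refine ⟨x₀, ?_⟩
    rw [abs_real_nHit_imhJump_sector_sub_eq hw hw0 hπ hH htop hbot t x₀,
      Set.indicator_of_notMem (Set.mem_compl_iff _ _ |>.1 hx₀), zero_sub, abs_neg,
      abs_of_nonneg measureReal_nonneg]
    exact mul_le_mul_of_nonneg_right h (pow_nonneg hr t)
  · refine ⟨x₁, ?_⟩
    rw [abs_real_nHit_imhJump_sector_sub_eq hw hw0 hπ hH htop hbot t x₁,
      Set.indicator_of_mem hx₁, Pi.one_apply, abs_of_nonneg (sub_nonneg.2 measureReal_le_one)]
    exact mul_le_mul_of_nonneg_right (by linarith) (pow_nonneg hr t)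

/-- **VII'S CONSTANT IS OPTIMAL IN THE SECTOR MODEL**: if the top sector is non-empty and the
bottom sector has positive model mass, every uniform minorisation constant of `J̃` by `π̃` is at
most `ā`. -/
theorem le_lintegral_imhAcceptMass_of_minorisation_sector (hw : Measurable w)
    (hw0 : ∀ x, 0 < w x) [IsProbabilityMeasure π]
    (hπ : (q.withDensity fun x => ENNReal.ofReal (w x)) = π) {H : Set Ω} (hH : MeasurableSet H)
    (htop : ∀ x ∈ H, ∀ y, w y ≤ w x) (hbot : ∀ x ∉ H, ∀ y, w x ≤ w y) (hne : H.Nonempty)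
    (hq : q Hᶜ ≠ 0) {c : ℝ≥0∞}
    (hc : ∀ x, ∀ ⦃B : Set Ω⦄, MeasurableSet B → c * imhTilt q w π B ≤ imhJump q w x B) :
    c ≤ ∫⁻ y, imhAcceptMass q w y ∂π := by
  obtain ⟨xt, hxt⟩ := hne
  exact le_lintegral_imhAcceptMass_of_forall_minorisation hw hw0 hπ (htop xt hxt) hH.compl
    (fun y hy => hbot y (Set.mem_compl_iff _ _ |>.1 hy)) hq hc

end Summit.Ventures.LatticeQCDFlow.Scoring
end
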